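import Summits.HodgeConjecture.HodgeConjecture.Theorems.F0P3SpectralPacketUnitarizableByOccurrence  -- ★ `cmOccursInDiscreteSpectrum`, ★ `cmDatum`, ★ `adelicGroupData`
import Literature.NumberTheory.Automorphic.SmoothCharacterOfCharacter                               -- ★ `SmoothIrrep.ofChar`, ★ `IrrClass.mk_ofChar_eq_mk_ofChar_iff`
import Literature.NumberTheory.Rogawski1990.U3PrincipalSeriesReducibility                           -- ★ `IrrClass.IsSquareIntegrable`
import Literature.NumberTheory.Automorphic.HeckeEigencharacterPackage                               -- ★ `IrrClass.IsAdmissible`, ★ `IrrClass.IsSpherical`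
import Literature.NumberTheory.Automorphic.LocalIrrepAdmissibleSplit                                -- ★ `localSplitEquiv` (split place `U(H)(L⁺_v) ≃ₜ* GL_N(L_w)`)
import Literature.NumberTheory.Automorphic.LocalUnitaryGroupCongrMeasure                            -- ★ instance `secondCountableTopology_cmDatum_local`
import Literature.NumberTheory.GaloisRepresentations.FrobeniusDensityTheorem                        -- ★ `splitPrimes`, ★ `hasStrongDirichletDensity_splitPrimes`
import HarnessLib

/-!
# `K2E1GlobaliseSquareIntegrableU2FiniteMeasureObstruction` — the socket `sig_K2E1GlobaliseSquareIntegrableU2` (as typed) lets a FINITE measure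
# stand in for the Haar measure of `U(Φ₂)(L⁺_v) ⧸ Z`, and is then incompatible with the countability of the discrete automorphic spectrum

Track B ∕ K2-LIT, crux h413 = `stmt-HodgeConjecture-24833`, route of record `HCCMUnconditional`; prover seat `hodgecm-mathlib-K2E1-p05` (g0); lane
`--supports stmt-HodgeConjecture-24833` (count-neutral).  THEOREMS ONLY (no `def`, no `instance`, no notation, no named-fact hypothesis, no `sorry`).
Socket audited: `sig_K2E1GlobaliseSquareIntegrableU2` of `Cruxes/H413/Lines/K2_E1_TraceFormulaBetaSigs_GlobalIndex.lean` (ED. 2, :107).  Its measure on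
`U(Φ₂)(L⁺_v) ⧸ Z(U(Φ₂)(L⁺_v))` is bound `[μZ.IsOpenPosMeasure] [IsFiniteMeasureOnCompacts μZ]` — NO invariance — while the tree's «square-integrable modulo
the centre» (★ `IrrClass.IsSquareIntegrable`, ★ `Representation.IsSquareIntegrableModCenter`) is the DOMINATION form `‖c_{φ,v}(g)‖ ≤ f(gZ)`, `f ∈ L²(μZ)`,
meaningful only for a Haar `μZ` (the tree's own ★ `KeysCaseTwo` binds `[μZ.IsHaarMeasure]`).

**What is proved (kernel-checked).**
* §1 `exists_isFiniteMeasure_isOpenPosMeasure`: a separable non-empty Borel space carries a FINITE measure positive on non-empty opens (`Σ 2⁻ⁿ δ_{xₙ}`);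
  `isSquareIntegrable_mk_ofChar_of_isFiniteMeasure`: for a finite `μZ` every one-dimensional class `⟦ℂ_ξ⟧` with `ξ` UNITARY (open kernel) is
  «square-integrable» (`‖c_{φ,v}‖ ≡ ‖φ v‖`); `isAdmissible_mk_ofChar`.
* §2 `exists_injective_unitaryChar_gl`: on `GL_N(L_w)` (`N ≥ 1`) the unramified characters `ξ_u = u^{ord_w det}`, `u ∈ ℂˣ`, have open kernel, are unitary for
  `‖u‖ = 1`, and `u ↦ ξ_u` is injective (evaluate at `diag(ϖ_w, 1, …, 1)`).
* §3 `exists_injective_family_of_split`: at a place `v` of `L⁺` SPLIT in `L` (`w ∣ v`, `c • w ≠ w`), for `H` hermitian with `det H` a unit and ANY finite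
  `μZ`, there is an INJECTIVE map `Circle → IrrClass (U(H)(L⁺_v))` into the admissible, `μZ`-square-integrable classes (transport along ★ `localSplitEquiv`).
* §4 `exists_split_place`: every CM field has a finite place of `L⁺` split in `L` (★ `hasStrongDirichletDensity_splitPrimes`, density `½ > 0`).
* §5 `not_sig_K2E1GlobaliseSquareIntegrableU2_of_countable_occurring`: IF for every CM field `L`, hermitian datum and place `v` the set of `v`-components
  of the families OCCURRING in the discrete spectrum (★ `cmOccursInDiscreteSpectrum`, over all automorphic measures) is COUNTABLE, THEN the socket's
  statement (type pasted verbatim, the organ's reducible `Pl L = HeightOneSpectrum (𝓞 L⁺)` inlined) is FALSE: at `L = ℚ(ζ₃)`, `Φ₂ = antidiag(1,1)`, a split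
  `v`, the Borel σ-algebra and the finite measure of §1, the socket would inject the circle into a countable set.

**Why the hypothesis holds (not formalised here).**  For ONE automorphic measure `μ` the occurring families are countable — distinct families have
non-isomorphic finite components, hence orthogonal isotypic parts in the separable `L²(U(H)(L⁺)\U(H)(𝔸))` [BorelJacquet1979 §4.6] (socket #2
`sig_K2E1OccursCountable` of the same module, seat K2E1-p02); automorphic measures are unique up to a positive scalar (★ `isAutomorphicMeasure_unique_smul_cmDatum`)
and occurrence is unchanged under `μ ↦ c • μ` (same closed invariant subspaces of `L²`).  A second, independent witness family (not used): with
`μZ := e^{−h²}·Haar`, `h` the Cartan height, non-unitarisable principal series qualify, against ★ `isUnitarizable_of_cmOccursInDiscreteSpectrum`.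

**What survives (the dealer's re-cut, seat memo `K2/K2E1-p05/g0/RED-sig5-…md`).**  ONE binder: `[μZ.IsHaarMeasure]` in place of
`[μZ.IsOpenPosMeasure] [IsFiniteMeasureOnCompacts μZ]` — then `ρ₀` is in the discrete series of `U(Φ₂)(L⁺_v)` and the statement is print's globalisation
[Rogawski1990 §13.8 p. 218 (i)–(iii); Langlands1980 p. 227; Clozel1986 Thm. 1]; the witnesses here have `|c_{id,1}| ≡ 1`, not `L²`-dominated for a Haar
measure on the non-compact `PGL₂(L_w)` (★ `measure_univ_lt_top_of_isSquareIntegrableModCenter_twist`).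

HONEST LABEL: HC_CM is proved only modulo the 7 printed citations (2 remaining named inputs: hLiu418 = `stmt-HodgeConjecture-24832`, h413 =
`stmt-HodgeConjecture-24833`) until rung 0 closes; this file proves no printed statement and moves no counter — it certifies an obstruction to one socket.

## References
* [Rogawski1990] J. D. Rogawski, *Automorphic Representations of Unitary Groups in Three Variables*, Ann. of Math. Stud. 123 (1990), §13.8 p. 218; §12.2 p. 173.
* [BorelJacquet1979] A. Borel, H. Jacquet, *Automorphic forms and automorphic representations*, Proc. Symp. Pure Math. 33.1 (1979), §4.6.
* [BushnellHenniart2006] C. J. Bushnell, G. Henniart, *The Local Langlands Conjecture for GL(2)* (2006), §1.5, §9.2 (unramified characters `χ ∘ det`).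
* [Marcus2018] D. A. Marcus, *Number Fields*, 2nd ed. (2018), Ch. 7 Thm. 43 (density of split primes).
-/

set_option autoImplicit false
-- the mandated namespace repeats the single-problem summit's segment (`HodgeConjecture.HodgeConjecture`)
set_option linter.dupNamespace false

noncomputable section

open NumberField IsDedekindDomain MeasureTheory Filter Topology
open scoped ENNReal Matrix MatrixGroups
open Literature.NumberTheory.Rogawski1990 Literature.NumberTheory.Automorphic Literature.NumberTheory.Automorphic.UnitaryGroup
open Literature.NumberTheory.GaloisRepresentations
open Summit.HodgeConjecture.HodgeConjecture.Cruxes.H413.F0P3GlobalPacketDiscrete (cmOccursInDiscreteSpectrum)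

namespace Summit.HodgeConjecture.HodgeConjecture.Cruxes.H413.K2E1GlobaliseSquareIntegrableU2FiniteMeasureObstruction

/-! ## §1 Finite open-positive measures, and one-dimensional unitary classes are «square-integrable» for them -/

/-- On a separable non-empty Borel space there is a FINITE measure positive on every non-empty open set: `Σₙ 2⁻ⁿ δ_{xₙ}` for a dense sequence
`(xₙ)`. [folklore] -/
theorem exists_isFiniteMeasure_isOpenPosMeasure (X : Type*) [TopologicalSpace X] [TopologicalSpace.SeparableSpace X] [Nonempty X]
    [MeasurableSpace X] [BorelSpace X] :
    ∃ μ : Measure X, IsFiniteMeasure μ ∧ μ.IsOpenPosMeasure := by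
  obtain ⟨u, hu⟩ := TopologicalSpace.exists_dense_seq X
  refine ⟨Measure.sum fun n : ℕ => ((1 / 2 : ℝ≥0∞) ^ n) • Measure.dirac (u n), ?_, ?_⟩
  · refine ⟨?_⟩
    rw [Measure.sum_apply _ MeasurableSet.univ]
    simp only [Measure.smul_apply, measure_univ, smul_eq_mul, mul_one]
    rw [ENNReal.tsum_geometric]
    norm_num
  · refine ⟨fun U hU hne => ?_⟩
    obtain ⟨n, hn⟩ := hu.exists_mem_open hU hne
    have h1 : ((1 / 2 : ℝ≥0∞) ^ n) • Measure.dirac (u n) U ≠ 0 := by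
      rw [Measure.dirac_apply' _ hU.measurableSet, Set.indicator_of_mem hn]
      simp
    intro h0
    rw [Measure.sum_apply _ hU.measurableSet, ENNReal.tsum_eq_zero] at h0
    exact h1 (by simpa using h0 n)

section OneDim

variable {G : Type} [Group G] [TopologicalSpace G] [IsTopologicalGroup G] [MeasurableSpace (G ⧸ Subgroup.center G)]

/-- For a FINITE measure `μZ` on `G ⧸ Z(G)` and a UNITARY character `ξ` with open kernel, the one-dimensional class `⟦ℂ_ξ⟧` is «square-integrable modulo
the centre» in the tree's domination sense: `‖c_{φ,v}(g)‖ = ‖φ v‖` is constant and constants are `L²` for a finite measure (cf. ★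
`isSquareIntegrableModCenter_trivial`). [cite: Rogawski1990, §12.2 (2) pp. 173–174] -/
theorem isSquareIntegrable_mk_ofChar_of_isFiniteMeasure (μZ : Measure (G ⧸ Subgroup.center G)) [IsFiniteMeasure μZ]
    (ξ : G →* ℂˣ) (hξ : IsOpen ((ξ.ker : Subgroup G) : Set G)) (hξ₁ : ∀ g, ‖((ξ g : ℂˣ) : ℂ)‖ = 1) :
    (IrrClass.mk (SmoothIrrep.ofChar ξ hξ)).IsSquareIntegrable μZ := by
  refine IrrClass.isSquareIntegrable_mk μZ _ ?_
  intro φ _ (v : ℂ)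
  refine ⟨fun _ => ‖φ v‖, memLp_const _, fun g => ?_⟩
  rw [Representation.matrixCoeff_apply, SmoothIrrep.ofChar_ρ_apply]
  have h : φ ((ξ g : ℂ) • v) = (ξ g : ℂ) • φ v := map_smul φ (ξ g : ℂ) v
  rw [smul_eq_mul, smul_eq_mul] at h
  rw [h, norm_mul, hξ₁ g, one_mul]

omit [MeasurableSpace (G ⧸ Subgroup.center G)] in
/-- The one-dimensional class `⟦ℂ_ξ⟧` (open kernel) is admissible (★ `isAdmissible_trivial_twist`). [cite: BushnellHenniart2006, §1.5] -/
theorem isAdmissible_mk_ofChar (ξ : G →* ℂˣ) (hξ : IsOpen ((ξ.ker : Subgroup G) : Set G)) :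
    (IrrClass.mk (SmoothIrrep.ofChar ξ hξ)).IsAdmissible :=
  (IrrClass.isAdmissible_mk _).2 (isAdmissible_trivial_twist hξ)

end OneDim

/-! ## §2 Unramified unitary characters of `GL_N(L_w)`: `ξ_u = u^{ord_w det}` -/

section GLChars

variable (L : Type) [Field L] [NumberField L] (w : HeightOneSpectrum (𝓞 L)) (N : ℕ)

/-- **An injective family of unitary unramified characters of `GL_N(L_w)` (`N ≥ 1`)**: `ξ_u(g) = u ^ {ord_w (det g)}`, `u ∈ ℂˣ` — open kernel (it
contains `{g | |det g|_w = 1}`), unitary when `‖u‖ = 1`, and `u ↦ ξ_u` is injective (`ξ_u(diag(ϖ_w, 1, …, 1)) = u⁻¹`).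
[cite: BushnellHenniart2006, §1.5, §9.2] -/
theorem exists_injective_unitaryChar_gl (hN : 0 < N) :
    ∃ χ : ℂˣ → (GL (Fin N) (w.adicCompletion L) →* ℂˣ),
      Function.Injective χ ∧ (∀ u, IsOpen (((χ u).ker : Subgroup (GL (Fin N) (w.adicCompletion L))) : Set (GL (Fin N) (w.adicCompletion L)))) ∧
        ∀ u : ℂˣ, ‖(u : ℂ)‖ = 1 → ∀ g, ‖((χ u g : ℂˣ) : ℂ)‖ = 1 := by
  classical
  -- the integer `ord_w (det g)` as `WithZero.log` of the valuation of the (non-zero) determinant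
  have hdet0 : ∀ g : GL (Fin N) (w.adicCompletion L), Valued.v ((g : Matrix (Fin N) (Fin N) (w.adicCompletion L)).det) ≠ 0 := fun g =>
    (Valuation.ne_zero_iff _).2 (Matrix.GeneralLinearGroup.det_ne_zero g)
  let χ : ℂˣ → (GL (Fin N) (w.adicCompletion L) →* ℂˣ) := fun u =>
    { toFun := fun g => u ^ WithZero.log (Valued.v ((g : Matrix (Fin N) (Fin N) (w.adicCompletion L)).det))
      map_one' := by simp
      map_mul' := fun g h => by
        rw [Units.val_mul, Matrix.det_mul, map_mul, WithZero.log_mul (hdet0 g) (hdet0 h), zpow_add] }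
  have hχ : ∀ u g, χ u g = u ^ WithZero.log (Valued.v ((g : Matrix (Fin N) (Fin N) (w.adicCompletion L)).det)) := fun _ _ => rfl
  -- a uniformiser `π ∈ L` at `w` and the test element `g₀ = diag(π, 1, …, 1)`
  obtain ⟨π, hπ⟩ := w.valuation_exists_uniformizer L
  have hπv : Valued.v (π : w.adicCompletion L) = WithZero.exp (-1 : ℤ) := by
    rw [HeightOneSpectrum.valuedAdicCompletion_eq_valuation', hπ]
  let D : Matrix (Fin N) (Fin N) (w.adicCompletion L) := Matrix.diagonal (Function.update (fun _ => 1) ⟨0, hN⟩ (π : w.adicCompletion L))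
  have hD : D.det = (π : w.adicCompletion L) := by
    rw [Matrix.det_diagonal, Finset.prod_update_of_mem (Finset.mem_univ _)]
    simp
  have hD0 : D.det ≠ 0 := by
    rw [hD]
    intro h0
    rw [h0, map_zero] at hπv
    exact WithZero.exp_ne_zero hπv.symm
  let g₀ : GL (Fin N) (w.adicCompletion L) := Matrix.GeneralLinearGroup.mkOfDetNeZero D hD0
  have hg₀ : ∀ u, χ u g₀ = u ^ (-1 : ℤ) := fun u => by
    rw [hχ]
    change u ^ WithZero.log (Valued.v D.det) = _
    rw [hD, hπv, WithZero.log_exp]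
  refine ⟨χ, fun u u' h => ?_, fun u => ?_, fun u hu g => ?_⟩
  · have h0 := DFunLike.congr_fun h g₀
    rw [hg₀, hg₀, zpow_neg, zpow_neg, zpow_one, zpow_one, inv_inj] at h0
    exact h0
  · -- the kernel is a neighbourhood of `1`: it contains `{g | |det g|_w = 1}`
    apply Subgroup.isOpen_of_mem_nhds _ (g := 1)
    have hcont : Continuous fun g : GL (Fin N) (w.adicCompletion L) => (g : Matrix (Fin N) (Fin N) (w.adicCompletion L)).det :=
      Units.continuous_val.matrix_det
    have hmem : {y : w.adicCompletion L | Valued.v y = Valued.v ((((1 : GL (Fin N) (w.adicCompletion L)) : Matrix (Fin N) (Fin N) (w.adicCompletion L))).det)} ∈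
        𝓝 ((((1 : GL (Fin N) (w.adicCompletion L)) : Matrix (Fin N) (Fin N) (w.adicCompletion L))).det) :=
      Valued.locally_const (hdet0 1)
    refine Filter.mem_of_superset (hcont.continuousAt.preimage_mem_nhds hmem) fun g hg => ?_
    simp only [Set.mem_preimage, Set.mem_setOf_eq, Units.val_one, Matrix.det_one, map_one] at hg
    rw [SetLike.mem_coe, MonoidHom.mem_ker, hχ, hg, WithZero.log_one, zpow_zero]
  · rw [hχ, Units.val_zpow_eq_zpow_val, norm_zpow, hu, one_zpow]

end GLChars

/-! ## §3 At a SPLIT place of `U(H)`: uncountably many admissible classes «square-integrable» for one finite measure -/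

section Split

variable (L : Type) [Field L] [NumberField L] [IsCMField L] {N : ℕ} (H : Matrix (Fin N) (Fin N) L)

/-- **The local half of the obstruction.**  `H` hermitian with `det H` a unit, `N ≥ 1`, `v` a finite place of `L⁺` SPLIT in `L` (`w ∣ v`, `c • w ≠ w`),
`μZ` ANY FINITE measure on `U(H)(L⁺_v) ⧸ Z` (any σ-algebra): the classes `⟦ℂ_{ξ_u ∘ e}⟧`, `u ∈ S¹`, `e = ` ★ `localSplitEquiv : U(H)(L⁺_v) ≃ₜ* GL_N(L_w)`,
`ξ_u` of `exists_injective_unitaryChar_gl`, form an INJECTIVE family `Circle → IrrClass (U(H)(L⁺_v))` of admissible, `μZ`-«square-integrable» classes.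
[cite: BushnellHenniart2006, §1.5, §9.2] [cite: Rogawski1990, §12.2 (2) pp. 173–174] -/
theorem exists_injective_family_of_split (hH : (H.map (cmConjRingHom L))ᵀ = H) (hHd : IsUnit H.det) (hN : 0 < N)
    (v : HeightOneSpectrum (𝓞 ↥(maximalRealSubfield L))) (w : PlacesOver L v) (hw : IsCMField.complexConj L • w.1 ≠ w.1)
    [MeasurableSpace ((cmDatum L N H).Local v ⧸ Subgroup.center ((cmDatum L N H).Local v))]
    (μZ : Measure ((cmDatum L N H).Local v ⧸ Subgroup.center ((cmDatum L N H).Local v))) [IsFiniteMeasure μZ] :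
    ∃ f : Circle → IrrClass ((cmDatum L N H).Local v), Function.Injective f ∧ ∀ u, (f u).IsAdmissible ∧ (f u).IsSquareIntegrable μZ := by
  let e : (cmDatum L N H).Local v ≃ₜ* GL (Fin N) (w.1.adicCompletion L) :=
    localSplitEquiv (IsCMField.complexConj L) H (IsCMField.complexConj_ne_one L)
      ((map_cmConjRingHom_eq_map_complexConj L H) ▸ hH) w hw (isUnit_placeForm_of_isUnit_det hHd w.1)
  obtain ⟨χ, hinj, hopen, hunit⟩ := exists_injective_unitaryChar_gl L w.1 N hN
  let eh : (cmDatum L N H).Local v →* GL (Fin N) (w.1.adicCompletion L) := e.toMulEquiv.toMonoidHom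
  have heh : ∀ g, eh g = e g := fun _ => rfl
  have hker : ∀ u, IsOpen ((((χ u).comp eh).ker : Subgroup ((cmDatum L N H).Local v)) : Set ((cmDatum L N H).Local v)) := fun u => by
    have hset : ((((χ u).comp eh).ker : Subgroup ((cmDatum L N H).Local v)) : Set ((cmDatum L N H).Local v)) =
        e ⁻¹' (((χ u).ker : Subgroup (GL (Fin N) (w.1.adicCompletion L))) : Set (GL (Fin N) (w.1.adicCompletion L))) := by
      ext g
      simp only [SetLike.mem_coe, MonoidHom.mem_ker, MonoidHom.comp_apply, Set.mem_preimage, heh]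
    rw [hset]
    exact (hopen u).preimage e.continuous
  have hcu : ∀ u : Circle, ‖((Circle.toUnits u : ℂˣ) : ℂ)‖ = 1 := fun u => by
    rw [Circle.toUnits_apply, Units.val_mk0, Circle.norm_coe]
  refine ⟨fun u => IrrClass.mk (SmoothIrrep.ofChar ((χ (Circle.toUnits u)).comp eh) (hker _)), fun u u' h => ?_, fun u => ⟨?_, ?_⟩⟩
  · have h1 := (IrrClass.mk_ofChar_eq_mk_ofChar_iff (hker _) (hker _)).1 h
    have h2 : χ (Circle.toUnits u) = χ (Circle.toUnits u') := by
      ext g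
      have h3 := DFunLike.congr_fun h1 (e.symm g)
      simp only [MonoidHom.comp_apply, heh, ContinuousMulEquiv.apply_symm_apply] at h3
      rw [h3]
    have h4 : Circle.toUnits u = Circle.toUnits u' := hinj h2
    have h5 : ((Circle.toUnits u : ℂˣ) : ℂ) = ((Circle.toUnits u' : ℂˣ) : ℂ) := by rw [h4]
    rw [Circle.toUnits_apply, Circle.toUnits_apply, Units.val_mk0, Units.val_mk0] at h5
    exact Circle.ext h5
  · exact isAdmissible_mk_ofChar _ _
  · exact isSquareIntegrable_mk_ofChar_of_isFiniteMeasure μZ _ _ (fun g => hunit _ (hcu u) _)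

end Split

/-! ## §4 Every CM field has a finite place of `L⁺` split in `L` -/

section SplitExists

variable (L : Type) [Field L] [NumberField L] [IsCMField L]

/-- **A CM field `L` has a finite place `v` of `L⁺` that SPLITS in `L`** (a `w ∣ v` with `c • w ≠ w`): the primes of `L⁺` splitting completely in the
quadratic Galois extension `L/L⁺` have Dirichlet density `½ > 0` (★ `hasStrongDirichletDensity_splitPrimes`), so one exists; above it lie `[L:L⁺] = 2`
primes (★ `ncard_primesOver_of_mem_splitPrimes`), and the two places above `v` are `w`, `c⁻¹ • w` (★ `PlacesOver.eq_or_eq_galInv`).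
[cite: Marcus2018, Ch. 7 Thm. 43] [cite: CasselsFrohlichANT1967, Ch. VII Prop. 1.2 (ii)] -/
theorem exists_split_place :
    ∃ (v : HeightOneSpectrum (𝓞 ↥(maximalRealSubfield L))) (w : PlacesOver L v), IsCMField.complexConj L • w.1 ≠ w.1 := by
  classical
  have h2 : Module.finrank (↥(maximalRealSubfield L)) L = 2 := Algebra.IsQuadraticExtension.finrank_eq_two _ L
  have hdens := hasStrongDirichletDensity_splitPrimes (M := ↥(maximalRealSubfield L)) (N := L)
  have hinf := hdens.infinite_setOf_prime_absNorm (by rw [h2]; norm_num)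
  obtain ⟨q, hq, -⟩ := hinf.nonempty
  have hcard : (q.asIdeal.primesOver (𝓞 L)).ncard = 2 := by
    rw [ncard_primesOver_of_mem_splitPrimes hq, h2]
  obtain ⟨Q₁, Q₂, hne, hQ⟩ := Set.ncard_eq_two.1 hcard
  have hQ₁ : Q₁ ∈ q.asIdeal.primesOver (𝓞 L) := by rw [hQ]; exact Set.mem_insert _ _
  have hQ₂ : Q₂ ∈ q.asIdeal.primesOver (𝓞 L) := by rw [hQ]; exact Set.mem_insert_of_mem _ (Set.mem_singleton _)
  let w₁ : PlacesOver L q :=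
    ⟨⟨Q₁, hQ₁.1, Ideal.ne_bot_of_mem_primesOver q.ne_bot hQ₁⟩, HeightOneSpectrum.ext hQ₁.2.over.symm⟩
  let w₂ : PlacesOver L q :=
    ⟨⟨Q₂, hQ₂.1, Ideal.ne_bot_of_mem_primesOver q.ne_bot hQ₂⟩, HeightOneSpectrum.ext hQ₂.2.over.symm⟩
  refine ⟨q, w₁, fun hfix => hne ?_⟩
  have hgal : PlacesOver.galInv (IsCMField.complexConj L) w₁ = w₁ := by
    apply Subtype.ext
    change (IsCMField.complexConj L)⁻¹ • w₁.1 = w₁.1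
    rw [inv_smul_eq_iff, hfix]
  have h12 : w₂ = w₁ := by
    rcases PlacesOver.eq_or_eq_galInv (IsCMField.complexConj L) (IsCMField.complexConj_ne_one L) w₁ w₂ with h | h
    · exact h
    · rw [h, hgal]
  exact (congrArg (fun w : PlacesOver L q => w.1.asIdeal) h12).symm

end SplitExists

/-! ## §5 The obstruction: countability of the occurring `v`-components refutes the socket as typed -/

/-- **`sig_K2E1GlobaliseSquareIntegrableU2` (as typed) is FALSE as soon as the `v`-components of the families occurring in the discrete spectrum form a
countable set.**  Hypothesis (print: [BorelJacquet1979 §4.6], separability of `L²`; the tree: socket #2 `sig_K2E1OccursCountable` + ★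
`isAutomorphicMeasure_unique_smul_cmDatum` + invariance of occurrence under `μ ↦ c • μ`): for every CM field `L`, `Φ ∈ M₂(L)` and finite place `v` of `L⁺`,
`{ρ v | μH automorphic, ρ occurs in L²_disc(U(Φ), μH)}` is countable.  Conclusion: the NEGATION of the socket's statement (type of
`Cruxes/H413/Lines/K2_E1_TraceFormulaBetaSigs_GlobalIndex.lean` :107 pasted verbatim, the organ's reducible `Pl L = HeightOneSpectrum (𝓞 L⁺)` inlined).
Proof: at `L = ℚ(ζ₃)` (★ `IsCyclotomicExtension.Rat.isCMField`), `Φ₂ = antidiag(1,1)` (★ `antidiagOne_isHermitian`, ★ `isUnit_antidiagOne_det`), a split `v`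
(§4), the Borel σ-algebra and a finite open-positive `μZ` on `U(Φ₂)(L⁺_v) ⧸ Z` (§1; ★ `secondCountableTopology_cmDatum_local`), the socket sends the
injective family of §3 into the countable set — but the circle is uncountable (`Circle.argEquiv`, `Cardinal.mk_Ioc_real`).
[cite: Rogawski1990, §13.8 p. 218 (i)–(iii); §12.2 (2) pp. 173–174] [cite: BorelJacquet1979, §4.6] -/
theorem not_sig_K2E1GlobaliseSquareIntegrableU2_of_countable_occurring
    (hcount : ∀ (L : Type) [Field L] [NumberField L] [IsCMField L] (Φ : Matrix (Fin 2) (Fin 2) L)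
      (v : HeightOneSpectrum (𝓞 ↥(maximalRealSubfield L))),
      {c : IrrClass ((UnitaryGroup.cmDatum L 2 Φ).Local v) |
        ∃ (μH : Measure (adelicGroupData (↥(maximalRealSubfield L)) L (IsCMField.complexConj L) 2 Φ).automorphicQuotient)
          (_ : (adelicGroupData (↥(maximalRealSubfield L)) L (IsCMField.complexConj L) 2 Φ).IsAutomorphicMeasure μH)
          (ρ : ∀ u : HeightOneSpectrum (𝓞 ↥(maximalRealSubfield L)), IrrClass ((UnitaryGroup.cmDatum L 2 Φ).Local u)),
          cmOccursInDiscreteSpectrum L 2 Φ μH ρ ∧ ρ v = c}.Countable) :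
    ¬ (∀ (L : Type) [Field L] [NumberField L] [IsCMField L] (Φ : Matrix (Fin 2) (Fin 2) L),
      Φ = Matrix.of (fun i j : Fin 2 => if i.val + j.val + 1 = 2 then (1 : L) else 0) →
      ∀ (v : HeightOneSpectrum (𝓞 ↥(maximalRealSubfield L)))
        [MeasurableSpace ((UnitaryGroup.cmDatum L 2 Φ).Local v ⧸ Subgroup.center ((UnitaryGroup.cmDatum L 2 Φ).Local v))]
        [BorelSpace ((UnitaryGroup.cmDatum L 2 Φ).Local v ⧸ Subgroup.center ((UnitaryGroup.cmDatum L 2 Φ).Local v))]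
        (μZ : Measure ((UnitaryGroup.cmDatum L 2 Φ).Local v ⧸ Subgroup.center ((UnitaryGroup.cmDatum L 2 Φ).Local v)))
        [μZ.IsOpenPosMeasure] [IsFiniteMeasureOnCompacts μZ]
        (ρ₀ : IrrClass ((UnitaryGroup.cmDatum L 2 Φ).Local v)), ρ₀.IsAdmissible → ρ₀.IsSquareIntegrable μZ →
        ∃ (μH : Measure (adelicGroupData (↥(maximalRealSubfield L)) L (IsCMField.complexConj L) 2 Φ).automorphicQuotient)
          (_ : (adelicGroupData (↥(maximalRealSubfield L)) L (IsCMField.complexConj L) 2 Φ).IsAutomorphicMeasure μH)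
          (ρ : ∀ u : HeightOneSpectrum (𝓞 ↥(maximalRealSubfield L)), IrrClass ((UnitaryGroup.cmDatum L 2 Φ).Local u)),
          cmOccursInDiscreteSpectrum L 2 Φ μH ρ ∧ ρ v = ρ₀ ∧
            ∀ u : HeightOneSpectrum (𝓞 ↥(maximalRealSubfield L)), u ≠ v → ∃ K : Subgroup ((UnitaryGroup.cmDatum L 2 Φ).Local u),
              IsOpen (K : Set ((UnitaryGroup.cmDatum L 2 Φ).Local u)) ∧ IsCompact (K : Set ((UnitaryGroup.cmDatum L 2 Φ).Local u)) ∧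
                (ρ u).IsSpherical K) := by
  intro hsig
  -- the CM field `ℚ(ζ₃)`, the split form `Φ₂ = antidiag(1,1)` and a split place `v`
  haveI : IsCyclotomicExtension {3} ℚ (CyclotomicField 3 ℚ) := CyclotomicField.isCyclotomicExtension 3 ℚ
  haveI : IsCMField (CyclotomicField 3 ℚ) := IsCyclotomicExtension.Rat.isCMField _ ⟨3, Set.mem_singleton 3, by norm_num⟩
  obtain ⟨v, w, hw⟩ := exists_split_place (CyclotomicField 3 ℚ)
  set L : Type := CyclotomicField 3 ℚ
  set Φ : Matrix (Fin 2) (Fin 2) L := Matrix.of (fun i j : Fin 2 => if i.val + j.val + 1 = 2 then (1 : L) else 0) with hΦ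
  -- the Borel σ-algebra on `U(Φ₂)(L⁺_v) ⧸ Z` and a finite open-positive measure on it
  letI : MeasurableSpace ((cmDatum L 2 Φ).Local v ⧸ Subgroup.center ((cmDatum L 2 Φ).Local v)) := borel _
  haveI : BorelSpace ((cmDatum L 2 Φ).Local v ⧸ Subgroup.center ((cmDatum L 2 Φ).Local v)) := ⟨rfl⟩
  haveI : SecondCountableTopology ((cmDatum L 2 Φ).Local v ⧸ Subgroup.center ((cmDatum L 2 Φ).Local v)) :=
    (QuotientGroup.isQuotientMap_mk _).secondCountableTopology QuotientGroup.isOpenMap_coe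
  obtain ⟨μZ, hfin, hpos⟩ :=
    exists_isFiniteMeasure_isOpenPosMeasure ((cmDatum L 2 Φ).Local v ⧸ Subgroup.center ((cmDatum L 2 Φ).Local v))
  haveI := hfin
  haveI := hpos
  -- the injective family of admissible, `μZ`-«square-integrable» classes at the split place
  obtain ⟨f, hf, hfp⟩ := exists_injective_family_of_split L Φ (antidiagOne_isHermitian L 2) (isUnit_antidiagOne_det L 2) two_pos v w hw μZ
  -- the socket makes every member of the family a `v`-component of an occurring family
  have hsub : Set.range f ⊆ {c : IrrClass ((UnitaryGroup.cmDatum L 2 Φ).Local v) |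
      ∃ (μH : Measure (adelicGroupData (↥(maximalRealSubfield L)) L (IsCMField.complexConj L) 2 Φ).automorphicQuotient)
        (_ : (adelicGroupData (↥(maximalRealSubfield L)) L (IsCMField.complexConj L) 2 Φ).IsAutomorphicMeasure μH)
        (ρ : ∀ u : HeightOneSpectrum (𝓞 ↥(maximalRealSubfield L)), IrrClass ((UnitaryGroup.cmDatum L 2 Φ).Local u)),
        cmOccursInDiscreteSpectrum L 2 Φ μH ρ ∧ ρ v = c} := by
    rintro _ ⟨u, rfl⟩
    obtain ⟨μH, hμH, ρ, hocc, hρv, -⟩ := hsig L Φ hΦ v μZ (f u) (hfp u).1 (hfp u).2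
    exact ⟨μH, hμH, ρ, hocc, hρv⟩
  -- hence the circle would be countable
  have hrange : (Set.range f).Countable := (hcount L Φ v).mono hsub
  haveI : Countable (Set.range f) := hrange.to_subtype
  have hcirc : Countable Circle :=
    (Function.Injective.countable (f := Set.rangeFactorization f) fun a b h => hf (congrArg Subtype.val h))
  have hIoc : Countable (Set.Ioc (-Real.pi) Real.pi) := Countable.of_equiv Circle Circle.argEquiv
  have hle : Cardinal.mk (Set.Ioc (-Real.pi) Real.pi) ≤ Cardinal.aleph0 := Cardinal.mk_le_aleph0_iff.2 hIoc
  rw [Cardinal.mk_Ioc_real (by linarith [Real.pi_pos])] at hle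
  exact absurd hle (not_le.2 Cardinal.aleph0_lt_continuum)

end Summit.HodgeConjecture.HodgeConjecture.Cruxes.H413.K2E1GlobaliseSquareIntegrableU2FiniteMeasureObstruction

end
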